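import Literature.Probability.LatticeModels.PolymerGasRatio
import HarnessLib

/-!
# Polymer gases: the weight of the families CONTAINING a pinned compatible family (Peierls' bound in polymer language)

A fourth layer on `PolymerGas` / `ClusterExpansion` / `PolymerGasRatio`.  For a hard-core polymer gas
`Ξ_Λ(w) = Σ_{A ⊆ Λ compatible} ∏_{γ ∈ A} w γ` and a *pinned* family `C ⊆ Λ`:

* `sum_prod_superset_compatible_eq_mul_polymerPartitionFunction` (**exact factorisation**, any
  activities): the compatible families `A ⊆ Λ` with `C ⊆ A` weigh exactly
  `(∏_{γ ∈ C} w γ) · Ξ_{Λ_C}(w)`, where `Λ_C = {γ' ∈ Λ ∖ C : γ' compatible with every member of C}`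
  (bijection `A ↦ A ∖ C`; the `#C = 1` case is the one-polymer recursion of `PolymerGas`).
* `sum_prod_superset_compatible_le_prod_mul_re_polymerPartitionFunction` (**joint presence ≤
  product of activities**, NON-NEGATIVE real activities): that weight is `≤ (∏_{γ ∈ C} w γ) · Ξ_Λ(w)`,
  because `Ξ_{Λ_C} ≤ Ξ_Λ` for sub-volumes of non-negative gases — positivity only, no smallness /
  Kotecký–Preiss condition (the UNION-type neighbour, "adjoining polymers `E` multiplies `Ξ` by at most
  `∏_{γ ∈ E}(1 + x γ)`", is `T4PeierlsDomination.pinnedGas_Z_union_le` of the Bałaban cell, likewise by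
  deletion-positivity; the Kotecký–Preiss ratio bounds of `PolymerGasRatio` / `ClusterExpansion` are needed
  only for signed or complex activities).  This is the abstract form of the monotonicity step of Peierls'
  argument: Friedli–Velenik prove `μ⁺(Γ ∋ γ_*) ≤ e^{−2β|γ_*|}` (Lemma 3.37, (3.34)) by writing the ratio
  (3.35) and observing after (3.36) that the constrained sum in the numerator "is less than the sum over
  all" configurations; for several pinned polymers the same removal `A ↦ A ∖ C` gives the product.
* `sum_prod_superset_compatible_div_le_prod` (probability form `≤ ∏_{γ ∈ C} w γ`), and the
  **covered-event version** `sum_prod_le_sum_prod_mul_re_polymerPartitionFunction_of_cover`: an event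
  of compatible families each of which contains some member of a finite list `𝒞` of pinned families
  weighs `≤ (Σ_{C ∈ 𝒞} ∏_{γ ∈ C} w γ) · Ξ_Λ(w)` (the union bound over the pins — Friedli–Velenik's
  display before (3.37), `μ(σ₀ = −1) ≤ Σ_{γ_*} μ(Γ ∋ γ_*)`, followed by (3.34) — the shape in which
  multi-contour / multi-polymer Peierls estimates are consumed).

Everything here is proved (finite combinatorics; the cited displays are the one-contour case, whose
proof is the one formalised); no named facts; no `def`; the two set-theoretic plumbing lemmas of the
bijection are `private`.

## References

* S. Friedli, Y. Velenik, *Statistical Mechanics of Lattice Systems* (CUP 2017), §3.7.2,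
  Lemma 3.37 with (3.34)–(3.36) (Peierls' estimate: the monotonicity step), Ch. 5 (polymer models).
  [FriedliVelenik2017]
* R. Kotecký, D. Preiss, Comm. Math. Phys. 103 (1986) 491–498, §3 (deletion identities).
  [KoteckyPreiss1986]
-/

noncomputable section

open Finset

namespace Literature.Probability.LatticeModels

variable {P : Type*} [DecidableEq P] {inc : P → P → Prop} [DecidableRel inc]

/-! ### The exact factorisation of the weight of the families containing `C` -/

/-- A compatible family containing `C` splits as `C` plus a compatible family of polymers outside `C`
compatible with every member of `C` (plumbing for the bijection `A ↦ A ∖ C`). [folklore] -/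
private theorem sdiff_subset_filter_of_isCompatible {Λ A C : Finset P} (hA : A ⊆ Λ) (hAc : IsCompatible inc A)
    (hCA : C ⊆ A) :
    A \ C ⊆ Λ.filter (fun γ' => γ' ∉ C ∧ ∀ γ ∈ C, ¬ inc γ γ') := by
  intro γ' hγ'
  obtain ⟨hγ'A, hγ'C⟩ := Finset.mem_sdiff.1 hγ'
  refine Finset.mem_filter.2 ⟨hA hγ'A, hγ'C, fun γ hγ => ?_⟩
  exact (isCompatible_iff.1 hAc) γ (hCA hγ) γ' hγ'A (fun h => hγ'C (h ▸ hγ))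

/-- Conversely, `B ∪ C` is compatible when `B` and `C` are and every member of `B` lies outside `C`
and is compatible with every member of `C` (symmetric incompatibility; plumbing for `B ↦ B ∪ C`).
[folklore] -/
private theorem isCompatible_union_of_subset_filter [Std.Symm inc] {Λ B C : Finset P}
    (hB : B ⊆ Λ.filter (fun γ' => γ' ∉ C ∧ ∀ γ ∈ C, ¬ inc γ γ')) (hBc : IsCompatible inc B)
    (hCc : IsCompatible inc C) : IsCompatible inc (B ∪ C) := by
  unfold IsCompatible at *
  rw [Finset.coe_union, Set.pairwise_union]
  refine ⟨hBc, hCc, fun γ' hγ' γ hγ _ => ?_⟩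
  have h := (Finset.mem_filter.1 (hB (Finset.mem_coe.1 hγ'))).2.2 γ (Finset.mem_coe.1 hγ)
  exact ⟨fun h' => h (Std.Symm.symm _ _ h'), h⟩

/-- **Exact factorisation.** For a compatible pinned family `C ⊆ Λ` and symmetric incompatibility,
`Σ_{A ⊆ Λ compatible, C ⊆ A} ∏_{γ ∈ A} w γ = (∏_{γ ∈ C} w γ) · Ξ_{Λ_C}(w)` with
`Λ_C = {γ' ∈ Λ : γ' ∉ C, γ' compatible with every γ ∈ C}` (bijection `A ↦ A ∖ C`, inverse `B ↦ B ∪ C`).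
[cite: KoteckyPreiss1986, §3 (deletion identities; the case #C = 1)] -/
theorem sum_prod_superset_compatible_eq_mul_polymerPartitionFunction [Std.Symm inc] (w : P → ℂ)
    {Λ C : Finset P} (hC : C ⊆ Λ) (hCc : IsCompatible inc C) :
    ∑ A ∈ Λ.powerset with (IsCompatible inc A ∧ C ⊆ A), ∏ γ ∈ A, w γ =
      (∏ γ ∈ C, w γ) * polymerPartitionFunction inc w (Λ.filter fun γ' => γ' ∉ C ∧ ∀ γ ∈ C, ¬ inc γ γ') := by
  set Λ' := Λ.filter (fun γ' => γ' ∉ C ∧ ∀ γ ∈ C, ¬ inc γ γ') with hΛ'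
  have hdisj : ∀ B, B ⊆ Λ' → Disjoint B C := fun B hB =>
    Finset.disjoint_left.2 fun γ hγB hγC => (Finset.mem_filter.1 (hB hγB)).2.1 hγC
  rw [polymerPartitionFunction_eq_sum_filter, Finset.mul_sum]
  refine Finset.sum_nbij' (fun A => A \ C) (fun B => B ∪ C) ?_ ?_ ?_ ?_ ?_
  · intro A hA
    simp only [Finset.mem_filter, Finset.mem_powerset] at hA ⊢
    exact ⟨sdiff_subset_filter_of_isCompatible hA.1 hA.2.1 hA.2.2, hA.2.1.mono Finset.sdiff_subset⟩
  · intro B hB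
    simp only [Finset.mem_filter, Finset.mem_powerset] at hB ⊢
    exact ⟨Finset.union_subset (hB.1.trans (Finset.filter_subset _ _)) hC,
      isCompatible_union_of_subset_filter hB.1 hB.2 hCc, Finset.subset_union_right⟩
  · intro A hA
    simp only [Finset.mem_filter, Finset.mem_powerset] at hA
    exact Finset.sdiff_union_of_subset hA.2.2
  · intro B hB
    simp only [Finset.mem_filter, Finset.mem_powerset] at hB
    exact Finset.union_sdiff_cancel_right (hdisj B hB.1)
  · intro A hA
    simp only [Finset.mem_filter, Finset.mem_powerset] at hA
    conv_lhs => rw [← Finset.sdiff_union_of_subset hA.2.2]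
    rw [Finset.prod_union Finset.sdiff_disjoint, mul_comm]

/-- The factorisation read for REAL activities: with `(w γ).im = 0`,
`Σ_{A ⊆ Λ compatible, C ⊆ A} ∏_{γ ∈ A} Re (w γ) = (∏_{γ ∈ C} Re (w γ)) · Re Ξ_{Λ_C}(w)` — the identity
behind Friedli–Velenik's (3.35)–(3.36) (one pinned contour `γ_*`: numerator `= e^{−2β|γ_*|} ×` the
constrained sum), for a pinned family. [cite: FriedliVelenik2017, Lemma 3.37, (3.35)–(3.36)] -/
theorem sum_prod_superset_compatible_eq_mul_re_polymerPartitionFunction [Std.Symm inc] {w : P → ℂ}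
    (hw : ∀ γ, (w γ).im = 0) {Λ C : Finset P} (hC : C ⊆ Λ) (hCc : IsCompatible inc C) :
    ∑ A ∈ Λ.powerset with (IsCompatible inc A ∧ C ⊆ A), ∏ γ ∈ A, (w γ).re =
      (∏ γ ∈ C, (w γ).re) *
        (polymerPartitionFunction inc w (Λ.filter fun γ' => γ' ∉ C ∧ ∀ γ ∈ C, ¬ inc γ γ')).re := by
  have hww : w = fun γ => (((w γ).re : ℝ) : ℂ) :=
    funext fun γ => Complex.ext (by simp) (by simp [hw γ])
  have h := congrArg Complex.re (sum_prod_superset_compatible_eq_mul_polymerPartitionFunction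
    (inc := inc) w hC hCc)
  rw [Complex.re_sum] at h
  have hl : ∀ A : Finset P, (∏ γ ∈ A, w γ).re = ∏ γ ∈ A, (w γ).re := by
    intro A
    rw [hww]
    simp only [Complex.ofReal_re]
    rw [← Complex.ofReal_prod, Complex.ofReal_re]
  simp only [hl] at h
  rw [h, hww]
  simp only [Complex.ofReal_re]
  rw [← Complex.ofReal_prod, Complex.re_ofReal_mul]

/-! ### Joint presence is at most the product of the activities (non-negative gases) -/

/-- **Joint presence ≤ product of activities** (Peierls' bound in polymer language).  For a hard-core
polymer gas with NON-NEGATIVE real activities and ANY finite family `C` of polymers, the compatible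
families `A ⊆ Λ` containing `C` weigh at most `(∏_{γ ∈ C} w γ) · Ξ_Λ(w)`: if `C ⊆ Λ` is compatible
this is the exact factorisation and `Ξ_{Λ_C} ≤ Ξ_Λ` (sub-volume of a non-negative gas); otherwise the
left side is an empty sum.  No smallness / Kotecký–Preiss condition is needed — only positivity;
Friedli–Velenik's (3.35)–(3.36) is the case of one contour. [cite: FriedliVelenik2017, Lemma 3.37, (3.34)–(3.36)] -/
theorem sum_prod_superset_compatible_le_prod_mul_re_polymerPartitionFunction [Std.Symm inc] {w : P → ℂ}
    (hw : ∀ γ, (w γ).im = 0) (hw0 : ∀ γ, 0 ≤ (w γ).re) (Λ C : Finset P) :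
    ∑ A ∈ Λ.powerset with (IsCompatible inc A ∧ C ⊆ A), ∏ γ ∈ A, (w γ).re ≤
      (∏ γ ∈ C, (w γ).re) * (polymerPartitionFunction inc w Λ).re := by
  by_cases h : C ⊆ Λ ∧ IsCompatible inc C
  · rw [sum_prod_superset_compatible_eq_mul_re_polymerPartitionFunction hw h.1 h.2]
    exact mul_le_mul_of_nonneg_left
      (re_polymerPartitionFunction_mono hw hw0 (Finset.filter_subset _ _))
      (Finset.prod_nonneg fun γ _ => hw0 γ)
  · have hempty : Λ.powerset.filter (fun A => IsCompatible inc A ∧ C ⊆ A) = ∅ := by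
      refine Finset.filter_eq_empty_iff.2 fun A hA hA' => h ⟨hA'.2.trans (Finset.mem_powerset.1 hA), ?_⟩
      exact hA'.1.mono hA'.2
    rw [hempty, Finset.sum_empty]
    exact mul_nonneg (Finset.prod_nonneg fun γ _ => hw0 γ)
      (zero_le_one.trans (one_le_re_polymerPartitionFunction hw hw0 Λ))

/-- **Probability form**: the relative weight of the families containing `C` is at most
`∏_{γ ∈ C} w γ` (divide by `Ξ_Λ(w) ≥ 1`). [cite: FriedliVelenik2017, Lemma 3.37, (3.34)–(3.36)] -/
theorem sum_prod_superset_compatible_div_le_prod [Std.Symm inc] {w : P → ℂ}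
    (hw : ∀ γ, (w γ).im = 0) (hw0 : ∀ γ, 0 ≤ (w γ).re) (Λ C : Finset P) :
    (∑ A ∈ Λ.powerset with (IsCompatible inc A ∧ C ⊆ A), ∏ γ ∈ A, (w γ).re) /
        (polymerPartitionFunction inc w Λ).re ≤ ∏ γ ∈ C, (w γ).re := by
  have hZ : 0 < (polymerPartitionFunction inc w Λ).re :=
    lt_of_lt_of_le one_pos (one_le_re_polymerPartitionFunction hw hw0 Λ)
  rw [div_le_iff₀ hZ]
  exact sum_prod_superset_compatible_le_prod_mul_re_polymerPartitionFunction hw hw0 Λ C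

/-! ### Covered events: the union bound over pinned families -/

/-- Subadditivity of non-negative sums over a finite union (not necessarily disjoint). [folklore] -/
private theorem sum_biUnion_le_sum_of_nonneg_aux {ι κ : Type*} [DecidableEq κ] (s : Finset ι)
    (t : ι → Finset κ) {f : κ → ℝ} (hf : ∀ b, 0 ≤ f b) :
    ∑ b ∈ s.biUnion t, f b ≤ ∑ a ∈ s, ∑ b ∈ t a, f b := by
  classical
  refine Finset.induction_on s (by simp) ?_
  intro a s ha ih
  rw [Finset.biUnion_insert, Finset.sum_insert ha]
  have hui := Finset.sum_union_inter (s₁ := t a) (s₂ := s.biUnion t) (f := f)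
  have hint : 0 ≤ ∑ b ∈ t a ∩ s.biUnion t, f b := Finset.sum_nonneg fun b _ => hf b
  linarith

/-- **Peierls' bound for a covered event.**  Let `E` be a finite set of families and `𝒞` a finite set
of pinned families such that every COMPATIBLE `A ∈ E` with `A ⊆ Λ` contains some `C ∈ 𝒞`.  Then, for
non-negative real activities, the compatible families of `E` inside `Λ` weigh at most
`(Σ_{C ∈ 𝒞} ∏_{γ ∈ C} w γ) · Ξ_Λ(w)` — the union bound over the pins (Friedli–Velenik's display before
(3.37)) followed by the joint-presence bound (their (3.34) per pin). [cite: FriedliVelenik2017, §3.7.2, (3.34) and the display before (3.37)] -/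
theorem sum_prod_le_sum_prod_mul_re_polymerPartitionFunction_of_cover [Std.Symm inc] {w : P → ℂ}
    (hw : ∀ γ, (w γ).im = 0) (hw0 : ∀ γ, 0 ≤ (w γ).re) (Λ : Finset P) (E 𝒞 : Finset (Finset P))
    (hcover : ∀ A ∈ E, A ⊆ Λ → IsCompatible inc A → ∃ C ∈ 𝒞, C ⊆ A) :
    ∑ A ∈ (Λ.powerset ∩ E) with IsCompatible inc A, ∏ γ ∈ A, (w γ).re ≤
      (∑ C ∈ 𝒞, ∏ γ ∈ C, (w γ).re) * (polymerPartitionFunction inc w Λ).re := by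
  have hnn : ∀ A : Finset P, 0 ≤ ∏ γ ∈ A, (w γ).re := fun A => Finset.prod_nonneg fun γ _ => hw0 γ
  -- cover: every term of the left side occurs in `⋃_{C ∈ 𝒞} {A ⊆ Λ compatible, C ⊆ A}`
  have hsub : (Λ.powerset ∩ E).filter (fun A => IsCompatible inc A) ⊆
      𝒞.biUnion fun C => Λ.powerset.filter fun A => IsCompatible inc A ∧ C ⊆ A := by
    intro A hA
    obtain ⟨hA, hAc⟩ := Finset.mem_filter.1 hA
    obtain ⟨hAΛ, hAE⟩ := Finset.mem_inter.1 hA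
    obtain ⟨C, hC, hCA⟩ := hcover A hAE (Finset.mem_powerset.1 hAΛ) hAc
    exact Finset.mem_biUnion.2 ⟨C, hC, Finset.mem_filter.2 ⟨hAΛ, hAc, hCA⟩⟩
  calc ∑ A ∈ (Λ.powerset ∩ E) with IsCompatible inc A, ∏ γ ∈ A, (w γ).re
      ≤ ∑ A ∈ 𝒞.biUnion (fun C => Λ.powerset.filter fun A => IsCompatible inc A ∧ C ⊆ A),
          ∏ γ ∈ A, (w γ).re := Finset.sum_le_sum_of_subset_of_nonneg hsub fun A _ _ => hnn A
    _ ≤ ∑ C ∈ 𝒞, ∑ A ∈ Λ.powerset with (IsCompatible inc A ∧ C ⊆ A), ∏ γ ∈ A, (w γ).re :=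
        sum_biUnion_le_sum_of_nonneg_aux _ _ (fun A => hnn A)
    _ ≤ ∑ C ∈ 𝒞, (∏ γ ∈ C, (w γ).re) * (polymerPartitionFunction inc w Λ).re :=
        Finset.sum_le_sum fun C _ =>
          sum_prod_superset_compatible_le_prod_mul_re_polymerPartitionFunction hw hw0 Λ C
    _ = (∑ C ∈ 𝒞, ∏ γ ∈ C, (w γ).re) * (polymerPartitionFunction inc w Λ).re := by
        rw [Finset.sum_mul]

end Literature.Probability.LatticeModels

end
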